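import Mathlib.Data.Nat.Choose.Basic
import Mathlib.Data.Nat.Factorial.Basic
import Mathlib.Algebra.BigOperators.Intervals
import Mathlib.Algebra.Order.BigOperators.Group.Finset
import Mathlib.Tactic
import Summits.CriticalPhenomena.PercolationContinuityZ3.Theorems.PercNearOneGluingNoHeavyLowerTailCoreLemma
import HarnessLib

/-!
# Bernstein averaging, part 1: the bivariate Cauchy product and the binomial / rising-factorial identities

Support file for the Sahi / Conjecture-P programme of route `PercNearOneGluingNoHeavy`
(`--supports stmt-CriticalPhenomena-4575`, prover prim-l12-p5 gen 27; proof notes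
`prim-l12-p5/CORE-g26.md` §3.1 and `prim-l12-p5/PROOF-DF1-g26.md` §2).  No definitions, no named
facts, no sorries.

The CORE CLAIM (TP₂ of `T_s(a,c) = ∑_{j,l} C(a,j)C(c,l) λ^j μ^l (s+j+l)^{(a+c-j-l)}`) is derived from
the CORE LEMMA (`CoreLemma.core_lemma`) by comparing the coefficients of `λ^{h₁} μ^{h₂}` in
`T(a+1,c+1)T(a,c)` and `T(a+1,c)T(a,c+1)` ('Bernstein averaging' over one ground set of odd block sizes
`2a+1`, `2c+1`).  This file provides the generic tools:

* `cauchy₁`, `cauchy₂` : coefficient form of the product of two (bivariate) polynomials written as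
  explicit finite sums;
* `choose_choose_choose` : the subset-of-a-subset identity
  `C(n,α)C(α,i)C(n-α,k) = C(n,i+k)C(i+k,i)C(n-i-k,α-i)`;
* `asc_step`, `zero_asc`, `buffer_fact₁`, `buffer_fact₂` : the rising factorials
  `(s+i)^{(v-i)}` of the list-structure counts against the binomial buffer `C(h+2s-2, i+s-1)` of the
  CORE LEMMA.
-/

namespace Summit.CriticalPhenomena.PercolationContinuityZ3.Theorems

namespace CoreCauchy

open Finset

/-! ### Cauchy products of explicit finite sums -/

/-- One-variable Cauchy product in coefficient form. -/
theorem cauchy₁ (F G : ℕ → ℝ) (A A' : ℕ) (x : ℝ) :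
    (∑ j ∈ range (A + 1), F j * x ^ j) * (∑ j ∈ range (A' + 1), G j * x ^ j) =
      ∑ h ∈ range (A + A' + 1), (∑ i ∈ range (h + 1),
        (if i ≤ A ∧ h - i ≤ A' then F i * G (h - i) else 0)) * x ^ h := by
  rw [sum_mul_sum]
  -- for fixed j, reindex j' = h - j
  have hrow : ∀ j ∈ range (A + 1), ∑ j' ∈ range (A' + 1), F j * x ^ j * (G j' * x ^ j') =
      ∑ h ∈ range (A + A' + 1), (if j ≤ h ∧ h - j ≤ A' then F j * G (h - j) * x ^ h else 0) := by
    intro j hj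
    have hjA : j ≤ A := by
      have := mem_range.mp hj
      omega
    rw [← sum_filter]
    refine sum_nbij' (fun j' => j + j') (fun h => h - j) ?_ ?_ ?_ ?_ ?_
    · intro j' hj'
      have := mem_range.mp hj'
      simp only [mem_filter, mem_range]
      omega
    · intro h hh
      simp only [mem_filter, mem_range] at hh
      simp only [mem_range]
      omega
    · intro j' _
      omega
    · intro h hh
      simp only [mem_filter, mem_range] at hh
      omega
    · intro j' _
      rw [show j + j' - j = j' by omega, pow_add]
      ring
  rw [sum_congr rfl hrow, sum_comm]
  refine sum_congr rfl fun h _ => ?_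
  rw [sum_mul]
  -- both sides are the sum of the same function supported on `i ≤ min A h`
  have hL : ∑ j ∈ range (A + 1), (if j ≤ h ∧ h - j ≤ A' then F j * G (h - j) * x ^ h else 0) =
      ∑ j ∈ range (A + 1),
        (if j ≤ A ∧ j ≤ h ∧ h - j ≤ A' then F j * G (h - j) * x ^ h else 0) := by
    refine sum_congr rfl fun j hj => ?_
    have hjA : j ≤ A := by
      have := mem_range.mp hj
      omega
    simp only [hjA, true_and]
  have hR : ∑ i ∈ range (h + 1), (if i ≤ A ∧ h - i ≤ A' then F i * G (h - i) else 0) * x ^ h =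
      ∑ i ∈ range (h + 1),
        (if i ≤ A ∧ i ≤ h ∧ h - i ≤ A' then F i * G (h - i) * x ^ h else 0) := by
    refine sum_congr rfl fun i hi => ?_
    have hih : i ≤ h := by
      have := mem_range.mp hi
      omega
    simp only [hih, true_and]
    split_ifs <;> simp
  rw [hL, hR]
  refine CoreLemma.sum_range_eq_of_support _ A h (fun i hi => ?_) (fun i hi => ?_)
  · rw [if_neg (by omega)]
  · rw [if_neg (by omega)]

/-- Two-variable Cauchy product in coefficient form. -/
theorem cauchy₂ (f g : ℕ → ℕ → ℝ) (A B A' B' : ℕ) (x y : ℝ) :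
    (∑ j ∈ range (A + 1), ∑ l ∈ range (B + 1), f j l * (x ^ j * y ^ l)) *
      (∑ j ∈ range (A' + 1), ∑ l ∈ range (B' + 1), g j l * (x ^ j * y ^ l)) =
    ∑ h₁ ∈ range (A + A' + 1), ∑ h₂ ∈ range (B + B' + 1),
      (∑ i₁ ∈ range (h₁ + 1), ∑ i₂ ∈ range (h₂ + 1),
        (if (i₁ ≤ A ∧ h₁ - i₁ ≤ A') ∧ (i₂ ≤ B ∧ h₂ - i₂ ≤ B') then
          f i₁ i₂ * g (h₁ - i₁) (h₂ - i₂) else 0)) * (x ^ h₁ * y ^ h₂) := by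
  -- collect the `y`-sums as coefficients of `x ^ j`
  have hF : ∑ j ∈ range (A + 1), ∑ l ∈ range (B + 1), f j l * (x ^ j * y ^ l) =
      ∑ j ∈ range (A + 1), (∑ l ∈ range (B + 1), f j l * y ^ l) * x ^ j := by
    refine sum_congr rfl fun j _ => ?_
    rw [sum_mul]
    refine sum_congr rfl fun l _ => ?_
    ring
  have hG : ∑ j ∈ range (A' + 1), ∑ l ∈ range (B' + 1), g j l * (x ^ j * y ^ l) =
      ∑ j ∈ range (A' + 1), (∑ l ∈ range (B' + 1), g j l * y ^ l) * x ^ j := by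
    refine sum_congr rfl fun j _ => ?_
    rw [sum_mul]
    refine sum_congr rfl fun l _ => ?_
    ring
  rw [hF, hG, cauchy₁]
  refine sum_congr rfl fun h₁ _ => ?_
  -- the inner products are Cauchy products in `y`
  have hinner : ∀ i₁ : ℕ,
      (if i₁ ≤ A ∧ h₁ - i₁ ≤ A' then
        (∑ l ∈ range (B + 1), f i₁ l * y ^ l) * (∑ l ∈ range (B' + 1), g (h₁ - i₁) l * y ^ l) else 0) =
      ∑ h₂ ∈ range (B + B' + 1), (∑ i₂ ∈ range (h₂ + 1),
        (if (i₁ ≤ A ∧ h₁ - i₁ ≤ A') ∧ (i₂ ≤ B ∧ h₂ - i₂ ≤ B') then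
          f i₁ i₂ * g (h₁ - i₁) (h₂ - i₂) else 0)) * y ^ h₂ := by
    intro i₁
    by_cases hP : i₁ ≤ A ∧ h₁ - i₁ ≤ A'
    · rw [if_pos hP, cauchy₁]
      refine sum_congr rfl fun h₂ _ => ?_
      congr 1
      refine sum_congr rfl fun i₂ _ => ?_
      simp only [hP, true_and]
    · rw [if_neg hP]
      symm
      refine sum_eq_zero fun h₂ _ => ?_
      rw [sum_eq_zero fun i₂ _ => by rw [if_neg (fun h => hP h.1)]]
      simp
  simp_rw [hinner, sum_mul]
  -- ∑_{i₁} ∑_{h₂} ∑_{i₂} c y^h₂ x^h₁ = ∑_{h₂} ∑_{i₁} ∑_{i₂} c (x^h₁ y^h₂)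
  rw [sum_comm]
  refine sum_congr rfl fun h₂ _ => sum_congr rfl fun i₁ _ => sum_congr rfl fun i₂ _ => ?_
  ring

/-! ### The subset-of-a-subset identity -/

/-- `C(n,α)·C(α,i)·C(n-α,k) = C(n,i+k)·C(i+k,i)·C(n-(i+k),α-i)` (`i ≤ α ≤ n`, `k ≤ n-α`): both sides
count the pairs `(V,H)` with `|V| = α`, `|H| = i+k`, `|V ∩ H| = i` in an `n`-set. -/
theorem choose_choose_choose (n α i k : ℕ) (hi : i ≤ α) (hα : α ≤ n) (hk : k ≤ n - α) :
    n.choose α * (α.choose i * (n - α).choose k) =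
      n.choose (i + k) * ((i + k).choose i * (n - (i + k)).choose (α - i)) := by
  have h1 : n.choose α * α.choose i = n.choose i * (n - i).choose (α - i) := Nat.choose_mul hi
  have h2 : n.choose (i + k) * (i + k).choose i = n.choose i * (n - i).choose (i + k - i) :=
    Nat.choose_mul (by omega)
  rw [show i + k - i = k by omega] at h2
  have h3 : (n - i).choose (α - i + k) * (α - i + k).choose (α - i) =
      (n - i).choose (α - i) * ((n - i) - (α - i)).choose (α - i + k - (α - i)) :=
    Nat.choose_mul (by omega)
  rw [show α - i + k - (α - i) = k by omega, show (n - i) - (α - i) = n - α by omega] at h3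
  have h4 : (n - i).choose (α - i + k) * (α - i + k).choose k =
      (n - i).choose k * ((n - i) - k).choose (α - i + k - k) :=
    Nat.choose_mul (by omega)
  rw [show α - i + k - k = α - i by omega, show (n - i) - k = n - (i + k) by omega] at h4
  have h5 : (α - i + k).choose (α - i) = (α - i + k).choose k := Nat.choose_symm_add
  calc n.choose α * (α.choose i * (n - α).choose k)
      = (n.choose α * α.choose i) * (n - α).choose k := by ring
    _ = n.choose i * ((n - i).choose (α - i) * (n - α).choose k) := by rw [h1]; ring
    _ = n.choose i * ((n - i).choose (α - i + k) * (α - i + k).choose (α - i)) := by rw [h3]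
    _ = n.choose i * ((n - i).choose (α - i + k) * (α - i + k).choose k) := by rw [h5]
    _ = n.choose i * ((n - i).choose k * (n - (i + k)).choose (α - i)) := by rw [h4]
    _ = (n.choose (i + k) * (i + k).choose i) * (n - (i + k)).choose (α - i) := by rw [h2]; ring
    _ = n.choose (i + k) * ((i + k).choose i * (n - (i + k)).choose (α - i)) := by ring

/-! ### Rising factorials against the binomial buffer -/

/-- `0^{(m)} = 0` for `m ≥ 1`. -/
theorem zero_asc (m : ℕ) (hm : 1 ≤ m) : (0 : ℕ).ascFactorial m = 0 := by
  obtain ⟨m', rfl⟩ : ∃ m', m = m' + 1 := ⟨m - 1, by omega⟩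
  induction m' with
  | zero => simp [Nat.ascFactorial_succ]
  | succ m ih => rw [Nat.ascFactorial_succ, ih (by omega)]; simp

/-- The step relating the list-structure counts of the two type pairs (legal exponents):
`(s+n)·(s+i)^{(n+2-i)}(s+j)^{(n-j)} = (s+n+1)·(s+i)^{(n+1-i)}(s+j)^{(n+1-j)}` for `i ≤ n+1`, `j ≤ n`. -/
theorem asc_step (s n i j : ℕ) (hi : i ≤ n + 1) (hj : j ≤ n) :
    (s + n) * ((s + i).ascFactorial (n + 2 - i) * (s + j).ascFactorial (n - j)) =
      (s + n + 1) * ((s + i).ascFactorial (n + 1 - i) * (s + j).ascFactorial (n + 1 - j)) := by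
  rw [show n + 2 - i = (n + 1 - i) + 1 by omega, show n + 1 - j = (n - j) + 1 by omega,
    Nat.ascFactorial_succ, Nat.ascFactorial_succ, show s + i + (n + 1 - i) = s + n + 1 by omega,
    show s + j + (n - j) = s + n by omega]
  ring

/-- Buffer form of `G_{n+2}(i)·G_n(j)` (types `(a+1,c+1)/(a,c)`, `i` hits inside, `j` outside):
`(i+j+2s-2)!·(s+i)^{(n+2-i)}·(s+j)^{(n-j)} = (s+n+1)!(s+n-1)!·C(i+j+2s-2, i+s-1)`. -/
theorem buffer_fact₁ (s n i j : ℕ) (hsn : 1 ≤ s + n) (h2 : 2 ≤ i + j + 2 * s) (hi : i ≤ n + 2)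
    (hj : j ≤ n) :
    (i + j + 2 * s - 2).factorial * ((s + i).ascFactorial (n + 2 - i) * (s + j).ascFactorial (n - j)) =
      (s + n + 1).factorial * (s + n - 1).factorial *
        (if 1 ≤ i + s then (i + j + 2 * s - 2).choose (i + s - 1) else 0) := by
  by_cases hs1 : 1 ≤ i + s
  · rw [if_pos hs1]
    by_cases hs2 : 1 ≤ j + s
    · have hA := Nat.factorial_mul_ascFactorial' (s + i) (n + 2 - i) (by omega)
      rw [show s + i + (n + 2 - i) - 1 = s + n + 1 by omega] at hA
      have hB := Nat.factorial_mul_ascFactorial' (s + j) (n - j) (by omega)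
      rw [show s + j + (n - j) - 1 = s + n - 1 by omega] at hB
      have hC := Nat.add_choose_mul_factorial_mul_factorial (s + j - 1) (s + i - 1)
      rw [show s + j - 1 + (s + i - 1) = i + j + 2 * s - 2 by omega,
        show s + i - 1 = i + s - 1 by omega] at hC
      calc (i + j + 2 * s - 2).factorial * ((s + i).ascFactorial (n + 2 - i) * (s + j).ascFactorial (n - j))
          = ((i + j + 2 * s - 2).choose (i + s - 1) * (s + j - 1).factorial * (i + s - 1).factorial) *
              ((s + i).ascFactorial (n + 2 - i) * (s + j).ascFactorial (n - j)) := by rw [hC]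
        _ = (i + j + 2 * s - 2).choose (i + s - 1) *
              (((s + i - 1).factorial * (s + i).ascFactorial (n + 2 - i)) *
               ((s + j - 1).factorial * (s + j).ascFactorial (n - j))) := by
            rw [show i + s - 1 = s + i - 1 by omega]; ring
        _ = (i + j + 2 * s - 2).choose (i + s - 1) * ((s + n + 1).factorial * (s + n - 1).factorial) := by
            rw [hA, hB]
        _ = (s + n + 1).factorial * (s + n - 1).factorial * (i + j + 2 * s - 2).choose (i + s - 1) := by
            ring
    · -- j + s = 0: the outside factor is 0^{(n)} = 0 and the buffer vanishes
      have hs0 : s = 0 := by omega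
      have hj0 : j = 0 := by omega
      subst hs0; subst hj0
      rw [show (0 : ℕ) + 0 = 0 by rfl, zero_asc (n - 0) (by omega),
        Nat.choose_eq_zero_of_lt (show i + 0 + 2 * 0 - 2 < i + 0 - 1 by omega)]
      simp
  · rw [if_neg hs1]
    have hs0 : s = 0 := by omega
    have hi0 : i = 0 := by omega
    subst hs0; subst hi0
    rw [show (0 : ℕ) + 0 = 0 by rfl, zero_asc (n + 2 - 0) (by omega)]
    simp

/-- Buffer form of `G_{n+1}(i)·G_{n+1}(j)` (types `(a+1,c)/(a,c+1)`):
`(i+j+2s-2)!·(s+i)^{(n+1-i)}·(s+j)^{(n+1-j)} = (s+n)!²·C(i+j+2s-2, i+s-1)`. -/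
theorem buffer_fact₂ (s n i j : ℕ) (h2 : 2 ≤ i + j + 2 * s) (hi : i ≤ n + 1) (hj : j ≤ n + 1) :
    (i + j + 2 * s - 2).factorial * ((s + i).ascFactorial (n + 1 - i) * (s + j).ascFactorial (n + 1 - j)) =
      (s + n).factorial * (s + n).factorial *
        (if 1 ≤ i + s then (i + j + 2 * s - 2).choose (i + s - 1) else 0) := by
  by_cases hs1 : 1 ≤ i + s
  · rw [if_pos hs1]
    by_cases hs2 : 1 ≤ j + s
    · have hA := Nat.factorial_mul_ascFactorial' (s + i) (n + 1 - i) (by omega)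
      rw [show s + i + (n + 1 - i) - 1 = s + n by omega] at hA
      have hB := Nat.factorial_mul_ascFactorial' (s + j) (n + 1 - j) (by omega)
      rw [show s + j + (n + 1 - j) - 1 = s + n by omega] at hB
      have hC := Nat.add_choose_mul_factorial_mul_factorial (s + j - 1) (s + i - 1)
      rw [show s + j - 1 + (s + i - 1) = i + j + 2 * s - 2 by omega,
        show s + i - 1 = i + s - 1 by omega] at hC
      calc (i + j + 2 * s - 2).factorial * ((s + i).ascFactorial (n + 1 - i) * (s + j).ascFactorial (n + 1 - j))
          = ((i + j + 2 * s - 2).choose (i + s - 1) * (s + j - 1).factorial * (i + s - 1).factorial) *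
              ((s + i).ascFactorial (n + 1 - i) * (s + j).ascFactorial (n + 1 - j)) := by rw [hC]
        _ = (i + j + 2 * s - 2).choose (i + s - 1) *
              (((s + i - 1).factorial * (s + i).ascFactorial (n + 1 - i)) *
               ((s + j - 1).factorial * (s + j).ascFactorial (n + 1 - j))) := by
            rw [show i + s - 1 = s + i - 1 by omega]; ring
        _ = (i + j + 2 * s - 2).choose (i + s - 1) * ((s + n).factorial * (s + n).factorial) := by
            rw [hA, hB]
        _ = (s + n).factorial * (s + n).factorial * (i + j + 2 * s - 2).choose (i + s - 1) := by ring
    · have hs0 : s = 0 := by omega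
      have hj0 : j = 0 := by omega
      subst hs0; subst hj0
      rw [show (0 : ℕ) + 0 = 0 by rfl, zero_asc (n + 1 - 0) (by omega),
        Nat.choose_eq_zero_of_lt (show i + 0 + 2 * 0 - 2 < i + 0 - 1 by omega)]
      simp
  · rw [if_neg hs1]
    have hs0 : s = 0 := by omega
    have hi0 : i = 0 := by omega
    subst hs0; subst hi0
    rw [show (0 : ℕ) + 0 = 0 by rfl, zero_asc (n + 1 - 0) (by omega)]
    simp

end CoreCauchy

end Summit.CriticalPhenomena.PercolationContinuityZ3.Theorems
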